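import Summits.AnomalousDissipation.AnomalousDissipation.Theorems.SawtoothPulseCascadeK1LocalisedCascadeKHTransportDuality
import Summits.AnomalousDissipation.AnomalousDissipation.Theorems.SawtoothPulseCascadeK1LocalisedCascadeKHStraightPairEnergy
import Summits.AnomalousDissipation.AnomalousDissipation.Theorems.SawtoothPulseCascadeK1LocalisedCascadeKHSheetPairEnergy

/-!
# K2 lane — (R-K) FOR THE V→H BLOCK BY NAME: one truncation bounds all larger ones (`transfer_V_H_of_trunc`)

prover ad-k1loc-p2 g12 (K2 lane, arbiter A28-1 (c)), crux workfile on the dir of stmt-AnomalousDissipation-19491; companion of `K2CombColumnLaw.lean`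
(v12′, 3b4431a9fd1a — which is at the 200 kB crux-file cap, hence this separate file) and of the memo `K2BookReduction-p2.md` (06098cab5c19) §2.
Over p4's VERBATIM definitions (`K2ConeSketch.lean` v1.4 / registered skeleton `K2AssemblyS4.lean` §0, reproduced below in THIS namespace because
`Cruxes/…` modules are not importable) this file proves:

* (F3) `cEnergy_inputState_V_mono` — the windowed input energy of a V source is monotone in the window;
* (F1) `modeProfile_child_inputState_V_eq`, `restrictShell_hFresh_child_eq` — for a V source of shell `s` and target shell `s′`, the fresh H densities of
  the four children on the shell-`s′` rows do NOT depend on the truncation once `2^s + 1 ≤ K₀ ≤ K` and `2^{s′+1} + 2 ≤ K₀`;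
* (F2)+(T) `cEnergy_vTransport_hPair_trunc_le` — for an H-pair density supported on the rows of `win K₀`, the level-1 energy of its V-transport at
  truncation `K ≥ K₀` exceeds the one at `K₀` by at most `Q_tot/(2π²(K₀−1))` (window sum of truncation-independent nonnegative terms; annulus tail by
  Parseval per column — `sum_norm_sq_vTransport_col_le`, tree `hasSum_sq_coeff` p703912 / `integral_norm_sq_blochPoly` p708619 — and the telescoping
  `sum_win_tail_inv_sq_le`);
* **`transfer_V_H_of_trunc`** — for `(α,β) ∈ [0,1)²`, ANY strain `θ`, `K₀ ≤ K`: if every V source `d` of shell `s` satisfies, AT THE SINGLE TRUNCATION `K₀`,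
  `Σ_children outEnergy_H^{(K₀)} + Q(d)/(2π²(K₀−1)) ≤ M²·cEnergy α β 0 K₀ (inputState … V d)` (the engine's Rayleigh quotient with one explicit extra
  diagonal term, `Q(d)` = squared fresh H densities of the children on the shell-`s′` rows), then `Transfer α β θ K V s H s′ M`.
  ONE certified evaluation per cell bounds the entry at EVERY `K ≥ K₀`: the `∀ K ≥ K₀c` direction of `EntryBoundsW`/`BookV7` for V→H cells is reduced
  to finitely many numbers. Creation-free (no `0.889/a`, no duality `66`, no Cauchy–Schwarz): as sharp as the engine's arithmetic up to the tail term,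
  whose relative size is `≈ 32·2^{s′}/K₀` (memo §2).
WHAT THIS IS NOT: no cap certified; V→V / H-source cells, (R-s′), (R-col), (R-class) not addressed; 19491/20024 open; AD not claimed.
-/

open Set MeasureTheory intervalIntegral

set_option linter.dupNamespace false

namespace Summit.AnomalousDissipation.AnomalousDissipation.Cruxes.K1LocalisedCascade.K2TruncationRK

open Literature.Analysis.FluidPDE.SawtoothCascade
open Summit.AnomalousDissipation.AnomalousDissipation.Theorems.SawtoothPulseCascade.K2PhaseBudget

noncomputable section

/-! ## Verbatim copies (p4: `K2ConeSketch.lean` v1.4 §0.1–§0.3, §1, §2, §4, §6.4) -/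

/-- The periodised Biot–Savart LINE KERNEL (p2's corrected sign). -/
def lineKernel (a β y : ℝ) : ℂ :=
  let κ : ℝ := 2 * Real.pi * |a|
  let r : ℝ := y - (⌊y⌋ : ℝ)
  let z : ℂ := Complex.exp (2 * Real.pi * β * Complex.I)
  Complex.exp (2 * Real.pi * β * (⌊y⌋ : ℝ) * Complex.I) *
    ((-(((Real.exp (-(κ * r)) : ℂ) / (1 - (starRingEnd ℂ z) * (Real.exp (-κ) : ℂ)))
          + (Real.exp (κ * (r - 1)) : ℂ) * z / (1 - z * (Real.exp (-κ) : ℂ)))) / (2 * κ : ℂ))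

/-- Transport multiplier of an H slot of total strain `θ` on the streamwise mode `a`. -/
def transportPhase (a θ y : ℝ) : ℂ :=
  Complex.exp (-(2 * Real.pi * a * θ * triWave y : ℝ) * Complex.I)

/-- The 2 × 2 Kelvin–Helmholtz block of the kink-sheet pair. -/
def blockX (a β : ℝ) : Matrix (Fin 2) (Fin 2) ℂ :=
  ((2 * Real.pi * a : ℝ) * Complex.I : ℂ) •
    !![-(1 / 4 : ℂ) - 2 * lineKernel a β 0, -2 * lineKernel a β (1 / 2);
       2 * starRingEnd ℂ (lineKernel a β (1 / 2)), (1 / 4 : ℂ) + 2 * lineKernel a β 0]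

/-- `λ(a, β) = -a²·c²(a, β)`. -/
def khLam (a β : ℝ) : ℝ := -(a ^ 2 * sawC2 a β)

/-- `C(t)`: `cosh(√λ t)` / `cos(√(-λ) t)` / `1`. -/
def propC (a β t : ℝ) : ℝ :=
  if 0 < khLam a β then Real.cosh (Real.sqrt (khLam a β) * t)
  else if khLam a β < 0 then Real.cos (Real.sqrt (-(khLam a β)) * t) else 1

/-- `Sn(t)`: `sinh(√λ t)/√λ` / `sin(√(-λ) t)/√(-λ)` / `t`. -/
def propSn (a β t : ℝ) : ℝ :=
  if 0 < khLam a β then Real.sinh (Real.sqrt (khLam a β) * t) / Real.sqrt (khLam a β)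
  else if khLam a β < 0 then Real.sin (Real.sqrt (-(khLam a β)) * t) / Real.sqrt (-(khLam a β)) else t

/-- The explicit propagator `P(t) = C(t)·1 + Sn(t)·X`. -/
def propagator (a β t : ℝ) : Matrix (Fin 2) (Fin 2) ℂ :=
  ((propC a β t : ℝ) : ℂ) • (1 : Matrix (Fin 2) (Fin 2) ℂ) + ((propSn a β t : ℝ) : ℂ) • blockX a β

/-- S-4 state of ONE line family. -/
structure LamState where
  interior : ℝ → ℂ
  sheets : List (ℝ × ℂ)

/-- The pure interior mode `ζ₀ ≡ 1`. -/
def pureMode : LamState := ⟨fun _ => 1, []⟩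

/-- A bare sheet pair on the kink lines with amplitudes `(q₊, q₋)` and no interior content. -/
def sheetPair (qp qm : ℂ) : LamState := ⟨fun _ => 0, [((1 / 4 : ℝ), qp), (-(1 / 4 : ℝ), qm)]⟩

/-- Forcing of the block at slot-time `s`. -/
def forcing (a β : ℝ) (st : LamState) (s : ℝ) : Fin 2 → ℂ :=
  let src : ℝ → ℂ := fun y0 =>
    (∫ y in (-(1 / 2 : ℝ))..(1 / 2), lineKernel a β (y0 - y) * st.interior y * transportPhase a s y)
      + (st.sheets.map (fun p => lineKernel a β (y0 - p.1) * p.2 * transportPhase a s p.1)).sum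
  ![((2 * Real.pi * a : ℝ) * Complex.I : ℂ) * (-2) * src (1 / 4),
    ((2 * Real.pi * a : ℝ) * Complex.I : ℂ) * 2 * src (-(1 / 4))]

/-- Fresh sheet amplitudes after strain `θ` (Duhamel): `q(θ) = ∫₀^θ P(θ - s) f(s) ds`. -/
def sheetAmps (a β θ : ℝ) (st : LamState) : Fin 2 → ℂ :=
  ∫ s in (0 : ℝ)..θ, (propagator a β (θ - s)).mulVec (forcing a β st s)

/-- THE SLOT MAP on one line family (S-2). -/
def slotMap (a β θ : ℝ) (st : LamState) : LamState :=
  ⟨fun y => st.interior y * transportPhase a θ y,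
   (st.sheets.map (fun p => (p.1, p.2 * transportPhase a θ p.1)))
     ++ [((1 / 4 : ℝ), sheetAmps a β θ st 0), (-(1 / 4 : ℝ), sheetAmps a β θ st 1)]⟩

/-- Transverse Fourier coefficient at `β + n`. -/
def coeff (β : ℝ) (st : LamState) (n : ℤ) : ℂ :=
  (∫ y in (-(1 / 2 : ℝ))..(1 / 2), st.interior y * Complex.exp (-(2 * Real.pi * (β + n) * y : ℝ) * Complex.I))
    + (st.sheets.map (fun p => p.2 * Complex.exp (-(2 * Real.pi * (β + n) * p.1 : ℝ) * Complex.I))).sum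

/-- Kinetic energy of the state on the family `(a, β)`. -/
def energy (a β : ℝ) (st : LamState) : ℝ :=
  ∑' n : ℤ, ‖coeff β st n‖ ^ 2 / (4 * Real.pi ^ 2 * (a ^ 2 + (β + n) ^ 2))

/-- Lattice state of one Bloch class `(α, β)`. -/
abbrev CState : Type := ℤ → ℤ → ℂ

/-- The truncation window `[-K, K]`. -/
def win (K : ℕ) : Finset ℤ := Finset.Icc (-(K : ℤ)) K

/-- Kinetic energy at level `ℓ` of the truncated state. -/
def cEnergy (α β : ℝ) (ℓ K : ℕ) (ζ : CState) : ℝ :=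
  ∑ m ∈ win K, ∑ n ∈ win K, ‖ζ m n‖ ^ 2 / (4 * Real.pi ^ 2 * (4 : ℝ) ^ ℓ * ((α + m) ^ 2 + (β + n) ^ 2))

/-- The transverse profile `y ↦ Σ_{|n| ≤ K} c(n) e^{2πi(β+n)y}` of a truncated coefficient row. -/
def modeProfile (β : ℝ) (K : ℕ) (c : ℤ → ℂ) : ℝ → ℂ :=
  fun y => ∑ n ∈ win K, c n * Complex.exp ((2 * Real.pi * (β + n) * y : ℝ) * Complex.I)

/-- H slot (strain `θ`), TRANSPORTED part: row `m` is the family `(α + m, β)`; its profile is multiplied by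
`transportPhase` and re-expanded (`K2SlotMap.coeff`), truncated to the window. -/
def hTransport (α β θ : ℝ) (K : ℕ) (ζ : CState) : CState := fun m n' =>
  if m ∈ win K ∧ n' ∈ win K then
    coeff β ⟨fun y => modeProfile β K (ζ m) y * transportPhase (α + m) θ y, []⟩ n'
  else 0

/-- V slot (strain `θ`), TRANSPORTED part: column `n` is the family `(β + n, α)` (roles of the coordinates exchanged),
its profile over `x` read from the column. -/
def vTransport (α β θ : ℝ) (K : ℕ) (ζ : CState) : CState := fun m' n =>
  if m' ∈ win K ∧ n ∈ win K then
    coeff α ⟨fun x => modeProfile α K (fun m => ζ m n) x * transportPhase (β + n) θ x, []⟩ m'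
  else 0

/-- V slot, FRESH V-pair densities per column. -/
def vFresh (α β θ : ℝ) (K : ℕ) (ζ : CState) : ℤ → Fin 2 → ℂ := fun n =>
  if n ∈ win K then sheetAmps (β + n) α θ ⟨modeProfile α K (fun m => ζ m n), []⟩ else 0

/-- Lattice state of a V-sheet pair with densities `p`. -/
def vPairState (α : ℝ) (p : ℤ → Fin 2 → ℂ) : CState := fun m n =>
  p n 0 * Complex.exp (-(Real.pi * (α + m) / 2 : ℝ) * Complex.I)
    + p n 1 * Complex.exp ((Real.pi * (α + m) / 2 : ℝ) * Complex.I)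

/-- Lower edges of the shells. -/
def shellLo : ℕ → ℝ
  | 0 => 0
  | 1 => 16 / 25
  | (s + 2) => (2 : ℝ) ^ (s + 1)

/-- Upper edge of shell `s`. -/
def shellHi (s : ℕ) : ℝ := shellLo (s + 1)

/-- `x` lies in shell `s`. -/
def InShell (s : ℕ) (x : ℝ) : Prop := shellLo s ≤ |x| ∧ |x| < shellHi s


/-! ## Verbatim copies, continued (p4 `K2ConeSketch.lean` §1–§4: children, fresh H pairs, phase pieces, piece types, shells, `Transfer`) -/

/-- CHILDREN re-framing (one cascade level down, period halves): the modes of class `(α, β)` with parities `(pm, pn)`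
form the child class `((α + pm)/2, (β + pn)/2)` with `ζ_child(m, n) = ζ(2m + pm, 2n + pn)`. -/
def child (pm pn : ℤ) (ζ : CState) : CState := fun m n => ζ (2 * m + pm) (2 * n + pn)

/-- The child class of `(α, β)` with parities `(pm, pn)`. -/
def childClass (α β : ℝ) (pm pn : ℤ) : ℝ × ℝ := ((α + pm) / 2, (β + pn) / 2)

/-- The parity set `{0, 1}`. -/
def parities : Finset ℤ := {0, 1}

/-- H slot, FRESH H-pair densities per row (`K2SlotMap.sheetAmps` of the row's family): `q m = (q₊, q₋)` on
`y = 1/4`, `y = -1/4`, streamwise wavenumber `α + m`. -/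
def hFresh (α β θ : ℝ) (K : ℕ) (ζ : CState) : ℤ → Fin 2 → ℂ := fun m =>
  if m ∈ win K then sheetAmps (α + m) β θ ⟨modeProfile β K (ζ m), []⟩ else 0

/-- Lattice state of an H-sheet pair with densities `q` (engine `SH`): `Z(m,n) = q₊(m) e^{-iπ(β+n)/2} + q₋(m) e^{iπ(β+n)/2}`. -/
def hPairState (β : ℝ) (q : ℤ → Fin 2 → ℂ) : CState := fun m n =>
  q m 0 * Complex.exp (-(Real.pi * (β + n) / 2 : ℝ) * Complex.I)
    + q m 1 * Complex.exp ((Real.pi * (β + n) / 2 : ℝ) * Complex.I)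

/-! ## 3. Phase pieces (material bookkeeping of one phase = H slot then V slot at one level) -/

/-- The three pieces a phase produces from the state entering it. -/
structure PhasePieces where
  /-- densities of the fresh straight V-pair created in the V slot (type V). -/
  freshV : ℤ → Fin 2 → ℂ
  /-- densities of the fresh H-pair created in the H slot; at phase end its state is `vTransport (hPairState freshH)` (type H). -/
  freshH : ℤ → Fin 2 → ℂ
  /-- debris: the entering state transported by both slots. -/
  debris : CState

/-- The phase pieces of class `(α, β)` at truncation `K` (strain `θ` per slot): `T = hTransport ζ`, `hq = hFresh ζ`,
the V slot acts on `T + hPairState hq`; fresh V densities from the whole of it, debris = `vTransport T`. -/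
def phasePieces (α β θ : ℝ) (K : ℕ) (ζ : CState) : PhasePieces :=
  let T : CState := hTransport α β θ K ζ
  let hq : ℤ → Fin 2 → ℂ := hFresh α β θ K ζ
  let S : CState := fun m n => T m n + hPairState β hq m n
  ⟨vFresh α β θ K S, hq, vTransport α β θ K T⟩

/-- The total state at phase end: fresh V pair + V-transported fresh H pair + debris. -/
def phaseTotal (α β θ : ℝ) (K : ℕ) (ζ : CState) : CState := fun m n =>
  let pc := phasePieces α β θ K ζ
  vPairState α pc.freshV m n + vTransport α β θ K (hPairState β pc.freshH) m n + pc.debris m n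

/-- The two piece types carrying a shell profile: fresh straight V pairs and once-transported H pairs. -/
inductive PType
  | V
  | H
  deriving DecidableEq, Fintype

/-- Densities restricted to shell `s` (offset `c` = the class coordinate along the sheet). -/
def restrictShell (s : ℕ) (c : ℝ) (d : ℤ → Fin 2 → ℂ) : ℤ → Fin 2 → ℂ :=
  fun (k : ℤ) => if shellLo s ≤ |c + (k : ℝ)| ∧ |c + (k : ℝ)| < shellHi s then d k else 0

/-- "the densities `d` are supported in shell `s`". -/
def SupportedIn (s : ℕ) (c : ℝ) (d : ℤ → Fin 2 → ℂ) : Prop := ∀ k : ℤ, ¬ InShell s (c + (k : ℝ)) → d k = 0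

/-- v1.3: "the densities `d` are supported in shell `s` AND in the truncation window `|k| ≤ K`" (the engine's input basis). -/
def SupportedInW (s : ℕ) (c : ℝ) (K : ℕ) (d : ℤ → Fin 2 → ℂ) : Prop :=
  SupportedIn s c d ∧ ∀ k : ℤ, k ∉ win K → d k = 0

/-- v1.3: truncation of a class state to the window `|m|, |n| ≤ K` (the engine's `(2K+1)²` arrays). -/
def truncW (K : ℕ) (ζ : CState) : CState :=
  fun (m n : ℤ) => if m ∈ win K ∧ n ∈ win K then ζ m n else 0

/-- The lattice state, at phase ENTRY (class `(α, β)`, level 0), of an input piece of type `t` with densities `d`: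
a straight V pair (v1.3: window-truncated, as the engine's `SV` on the `(2K+1)²` lattice), resp. an H pair V-transported once
(created in the previous H slot of the same level; `vTransport` is windowed already). -/
def inputState (α β θ : ℝ) (K : ℕ) : PType → (ℤ → Fin 2 → ℂ) → CState
  | PType.V, p => truncW K (vPairState α p)
  | PType.H, q => vTransport α β θ K (hPairState β q)

/-- The class coordinate along the sheets of type `t`: `β` for V pairs (densities in `β + n`), `α` for H pairs. -/
def alongCoord (α β : ℝ) : PType → ℝ
  | PType.V => β
  | PType.H => α

/-- Level-`ℓ` energy of the output piece `(t', s')` among the phase pieces `pc` of a class `(α', β')` sitting at level `ℓ`. -/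
def outEnergyAt (α' β' θ : ℝ) (K ℓ : ℕ) (s' : ℕ) (pc : PhasePieces) : PType → ℝ
  | PType.V => cEnergy α' β' ℓ K (vPairState α' (restrictShell s' β' pc.freshV))
  | PType.H => cEnergy α' β' ℓ K (vTransport α' β' θ K (hPairState β' (restrictShell s' α' pc.freshH)))

/-- Level-1 energy of the output piece `(t', s')` among the phase pieces `pc` of the child class `(α', β')`. -/
def outEnergy (α' β' θ : ℝ) (K : ℕ) (s' : ℕ) (pc : PhasePieces) : PType → ℝ :=
  outEnergyAt α' β' θ K 1 s' pc

/-- SHELL-TRANSFER ENTRY `M[(t', s'), (t, s)] ≤ M` for the parent class `(α, β)` at truncation `K`: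
every input piece of type `t` with densities in shell `s` produces, summed over the four children and after their
phase, an output piece `(t', s')` of level-1 energy ≤ `M²` × its own level-0 energy.  (WO-p4-K2-4 computes the sup.) -/
def Transfer (α β θ : ℝ) (K : ℕ) (t : PType) (s : ℕ) (t' : PType) (s' : ℕ) (M : ℝ) : Prop :=
  ∀ d : ℤ → Fin 2 → ℂ, SupportedInW s (alongCoord α β t) K d →
    (∑ pm ∈ parities, ∑ pn ∈ parities,
        outEnergy ((α + pm) / 2) ((β + pn) / 2) θ K s'
          (phasePieces ((α + pm) / 2) ((β + pn) / 2) θ K (child pm pn (inputState α β θ K t d))) t')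
      ≤ M ^ 2 * cEnergy α β 0 K (inputState α β θ K t d)

/-! ## Tools copied from `K2CombColumnLaw.lean` (§10, §14, §15) -/

/-- The triangle wave is continuous. -/
theorem continuous_triWave : Continuous triWave := by
  have h : triWave = (fun t : ℝ => 1 / 4 - |t - 1 / 2|) ∘ Int.fract ∘ (fun ξ : ℝ => ξ + 1 / 4) := by
    funext ξ; simp [triWave, Function.comp]
  rw [h]
  have hI : Continuous ((fun t : ℝ => 1 / 4 - |t - 1 / 2|) ∘ Int.fract) :=
    ContinuousOn.comp_fract'' (Continuous.continuousOn (by fun_prop)) (by norm_num)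
  exact hI.comp (continuous_id.add continuous_const)

/-- The transport phase is continuous in `y` and unimodular. -/
theorem continuous_transportPhase (a θ : ℝ) : Continuous (transportPhase a θ) := by
  unfold transportPhase
  have := continuous_triWave
  fun_prop

/-- `|transportPhase| = 1`. -/
theorem norm_transportPhase (a θ y : ℝ) : ‖transportPhase a θ y‖ = 1 := by
  unfold transportPhase
  rw [show -((2 * Real.pi * a * θ * triWave y : ℝ) : ℂ) * Complex.I = ((-(2 * Real.pi * a * θ * triWave y) : ℝ) : ℂ) * Complex.I by push_cast; ring]
  exact Complex.norm_exp_ofReal_mul_I _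

/-- The level-0 windowed energy of the V-source input state, spelled out (the window truncation is invisible inside `cEnergy`'s window sums). -/
theorem cEnergy_inputState_V (α β θ : ℝ) (K : ℕ) (d : ℤ → Fin 2 → ℂ) :
    cEnergy α β 0 K (inputState α β θ K PType.V d) = ∑ m ∈ win K, ∑ n ∈ win K,
      ‖d n 0 * Complex.exp (-(Real.pi * (α + m) / 2 : ℝ) * Complex.I) + d n 1 * Complex.exp ((Real.pi * (α + m) / 2 : ℝ) * Complex.I)‖ ^ 2 /
        (4 * Real.pi ^ 2 * ((α + m) ^ 2 + (β + n) ^ 2)) := by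
  unfold cEnergy
  refine Finset.sum_congr rfl fun m hm => Finset.sum_congr rfl fun n hn => ?_
  simp only [inputState, truncW, vPairState, if_pos (And.intro hm hn), pow_zero, mul_one]

/-- One column of `vTransport`, inside the window, is the transport coefficient of the column profile. -/
theorem vTransport_apply_of_mem (α β θ : ℝ) (K : ℕ) (ζ : CState) {m' n : ℤ} (hm' : m' ∈ win K) (hn : n ∈ win K) :
    vTransport α β θ K ζ m' n = ∫ x in (-(1 / 2 : ℝ))..(1 / 2),
      ((∑ m ∈ win K, ζ m n * Complex.exp ((2 * Real.pi * (α + m) * x : ℝ) * Complex.I)) *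
        Complex.exp (-((2 * Real.pi * (β + n) * θ * triWave x : ℝ) : ℂ) * Complex.I)) * Complex.exp (-(2 * Real.pi * (α + m') * x : ℝ) * Complex.I) := by
  simp only [vTransport, if_pos (And.intro hm' hn), coeff, modeProfile, transportPhase, List.map_nil, List.sum_nil, add_zero]


/-! ## §20 (v13) (R-K) FOR THE V→H BLOCK, BY NAME: ONE truncation bounds ALL larger ones (arbiter A28-1 (c); memo `K2BookReduction-p2.md` §2)

For a V source in shell `s`, an H target in shell `s′`, and `K ≥ K₀ ≥ max(2^s + 1, 2^{s′+1} + 2)`: (F1) the fresh H densities on the shell-`s′` rows of the four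
children do not depend on the truncation; (F2) the output energy is a window sum of truncation-independent nonnegative terms; (F3) the input energy is
monotone in the window; (T) the annulus `win K² ∖ win K₀²` carries at most `Q/(2π²(K₀−1))`, `Q` = the squared fresh densities (Parseval per column).
Hence `transfer_V_H_of_trunc`: ONE Rayleigh quotient at `K₀` (with the explicit extra term `Q/(2π²(K₀−1))`) gives `Transfer α β θ K V s H s′ M` for every
`K ≥ K₀` — creation-free, valid for every strain `θ`. -/

/-- `shellHi s ≤ 2^s`. -/
theorem shellHi_le_two_pow (s : ℕ) : shellHi s ≤ (2 : ℝ) ^ s := by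
  cases s with
  | zero => simp only [shellHi, shellLo]; norm_num
  | succ k => simp only [shellHi, shellLo]; rw [pow_succ]

/-- A density supported in shell `s` (class coordinate `c ∈ [0,1)`) vanishes at every `k` with `|k| ≥ 2^s + 1`. -/
theorem supportedIn_apply_eq_zero {s : ℕ} {c : ℝ} (hc0 : 0 ≤ c) (hc1 : c < 1) {d : ℤ → Fin 2 → ℂ} (hd : SupportedIn s c d) {k : ℤ}
    (hk : (2 : ℝ) ^ s + 1 ≤ |(k : ℝ)|) : d k = 0 := by
  refine hd k fun h => ?_
  have h2 := h.2
  have hs := shellHi_le_two_pow s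
  have : |(k : ℝ)| ≤ |c + k| + |c| := by
    have h := abs_add_le (c + k) (-c)
    rw [abs_neg, show c + (k : ℝ) + -c = k by ring] at h
    exact h
  rw [abs_of_nonneg hc0] at this
  linarith

/-- Membership in the window, unfolded. -/
theorem mem_win {K : ℕ} {x : ℤ} : x ∈ win K ↔ -(K : ℤ) ≤ x ∧ x ≤ K := by
  simp only [win, Finset.mem_Icc]

/-- **(F3)** The windowed input energy of a V source is monotone in the window. -/
theorem cEnergy_inputState_V_mono (α β θ : ℝ) {K₀ K : ℕ} (hK : K₀ ≤ K) (d : ℤ → Fin 2 → ℂ) :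
    cEnergy α β 0 K₀ (inputState α β θ K₀ PType.V d) ≤ cEnergy α β 0 K (inputState α β θ K PType.V d) := by
  rw [cEnergy_inputState_V, cEnergy_inputState_V]
  have hsub : win K₀ ⊆ win K := by
    intro x hx; rw [mem_win] at hx ⊢; omega
  refine (Finset.sum_le_sum_of_subset_of_nonneg hsub fun m _ _ => Finset.sum_nonneg fun n _ => by positivity).trans ?_
  exact Finset.sum_le_sum fun m _ => Finset.sum_le_sum_of_subset_of_nonneg hsub fun n _ _ => by positivity

/-- **(F1), profile level.** The row profile of a child of the V-source input state does not depend on the truncation once the window contains the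
source shell (`2^s + 1 ≤ K₀ ≤ K`) and the row (`2m + pm ∈ win K₀`). -/
theorem modeProfile_child_inputState_V_eq {α β θ : ℝ} (hβ0 : 0 ≤ β) (hβ1 : β < 1) {s : ℕ} {d : ℤ → Fin 2 → ℂ} (hd : SupportedIn s β d)
    {K₀ K : ℕ} (hK₀ : 2 ^ s + 1 ≤ K₀) (hK : K₀ ≤ K) {pm pn : ℤ} (hpn : pn ∈ parities) {m : ℤ} (hm : 2 * m + pm ∈ win K₀) :
    modeProfile ((β + pn) / 2) K (child pm pn (inputState α β θ K PType.V d) m) =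
      modeProfile ((β + pn) / 2) K₀ (child pm pn (inputState α β θ K₀ PType.V d) m) := by
  have hsub : win K₀ ⊆ win K := by
    intro x hx; rw [mem_win] at hx ⊢; omega
  have hpn' : pn = 0 ∨ pn = 1 := by simpa [parities] using hpn
  have hK₀r : (2 : ℝ) ^ s + 1 ≤ (K₀ : ℝ) := by exact_mod_cast hK₀
  -- a column index outside the small window carries no density
  have hzero : ∀ n : ℤ, n ∉ win K₀ → d (2 * n + pn) = 0 := by
    intro n hn
    rw [mem_win, not_and_or, not_le, not_le] at hn
    apply supportedIn_apply_eq_zero hβ0 hβ1 hd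
    have : (K₀ : ℝ) + 1 ≤ |((2 * n + pn : ℤ) : ℝ)| := by
      rcases hn with h | h
      · have h' : (n : ℝ) ≤ -(K₀ : ℝ) - 1 := by exact_mod_cast (show n ≤ -(K₀ : ℤ) - 1 by omega)
        rw [abs_of_neg (by push_cast; rcases hpn' with h1 | h1 <;> rw [h1] <;> push_cast <;> linarith)]
        push_cast; rcases hpn' with h1 | h1 <;> rw [h1] <;> push_cast <;> linarith
      · have h' : (K₀ : ℝ) + 1 ≤ n := by exact_mod_cast (show (K₀ : ℤ) + 1 ≤ n by omega)
        rw [abs_of_pos (by push_cast; rcases hpn' with h1 | h1 <;> rw [h1] <;> push_cast <;> linarith)]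
        push_cast; rcases hpn' with h1 | h1 <;> rw [h1] <;> push_cast <;> linarith
    linarith
  have hm' : 2 * m + pm ∈ win K := hsub hm
  funext y
  simp only [modeProfile, child, inputState, truncW]
  symm
  refine Finset.sum_subset_zero_on_sdiff hsub (fun n hn => ?_) (fun n hn => ?_)
  · rw [Finset.mem_sdiff] at hn
    have h0 := hzero n hn.2
    simp [vPairState, h0]
  · by_cases hdn : d (2 * n + pn) = 0
    · simp [vPairState, hdn]
    · have hn2 : 2 * n + pn ∈ win K₀ := by
        by_contra hc
        rw [mem_win, not_and_or, not_le, not_le] at hc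
        apply hdn
        apply supportedIn_apply_eq_zero hβ0 hβ1 hd
        rcases hc with h | h
        · have h' : (((2 * n + pn : ℤ)) : ℝ) ≤ -(K₀ : ℝ) - 1 := by exact_mod_cast (show 2 * n + pn ≤ -(K₀ : ℤ) - 1 by omega)
          rw [abs_of_neg (by linarith)]; linarith
        · have h' : (K₀ : ℝ) + 1 ≤ ((2 * n + pn : ℤ) : ℝ) := by exact_mod_cast (show (K₀ : ℤ) + 1 ≤ 2 * n + pn by omega)
          rw [abs_of_pos (by linarith)]; linarith
      rw [if_pos ⟨hm, hn2⟩, if_pos ⟨hm', hsub hn2⟩]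

/-- **(F1)** The fresh H densities of a child of the V-source input state, restricted to the target shell `s′`, do not depend on the truncation
(`2^s + 1 ≤ K₀`, `2^{s′+1} + 2 ≤ K₀`, `K₀ ≤ K`). -/
theorem restrictShell_hFresh_child_eq {α β : ℝ} (hα0 : 0 ≤ α) (hα1 : α < 1) (hβ0 : 0 ≤ β) (hβ1 : β < 1) (θ : ℝ) {s s' : ℕ}
    {d : ℤ → Fin 2 → ℂ} (hd : SupportedIn s β d) {K₀ K : ℕ} (hK₀ : 2 ^ s + 1 ≤ K₀) (hK₀' : 2 ^ (s' + 1) + 2 ≤ K₀) (hK : K₀ ≤ K)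
    {pm pn : ℤ} (hpm : pm ∈ parities) (hpn : pn ∈ parities) :
    restrictShell s' ((α + pm) / 2) (hFresh ((α + pm) / 2) ((β + pn) / 2) θ K (child pm pn (inputState α β θ K PType.V d))) =
      restrictShell s' ((α + pm) / 2) (hFresh ((α + pm) / 2) ((β + pn) / 2) θ K₀ (child pm pn (inputState α β θ K₀ PType.V d))) := by
  have hpm' : pm = 0 ∨ pm = 1 := by simpa [parities] using hpm
  have hK₀r : (2 : ℝ) ^ (s' + 1) + 2 ≤ (K₀ : ℝ) := by exact_mod_cast hK₀'
  have hs' := shellHi_le_two_pow s'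
  funext m
  simp only [restrictShell]
  split_ifs with hsh
  · -- the row is in the target shell: `|m| ≤ 2^{s'}`, so `m` and `2m+pm` are inside both windows
    have hlt : |(m : ℝ)| < (2 : ℝ) ^ s' + 1 := by
      have h2 := hsh.2
      have ha0 : 0 ≤ (α + pm) / 2 := by rcases hpm' with h | h <;> rw [h] <;> push_cast <;> linarith
      have : |(m : ℝ)| ≤ |(α + pm) / 2 + m| + |(α + pm) / 2| := by
        have h := abs_add_le ((α + pm) / 2 + m) (-((α + pm) / 2))
        rw [abs_neg, show (α + ↑pm) / 2 + (m : ℝ) + -((α + ↑pm) / 2) = m by ring] at h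
        exact h
      rw [abs_of_nonneg ha0] at this
      have ha1 : (α + pm) / 2 < 1 := by rcases hpm' with h | h <;> rw [h] <;> push_cast <;> linarith
      linarith
    have hmz : |m| ≤ (2 : ℤ) ^ s' := by
      have h' : ((|m| : ℤ) : ℝ) < (2 : ℝ) ^ s' + 1 := by rw [Int.cast_abs]; exact hlt
      have h'' : |m| < (2 : ℤ) ^ s' + 1 := by exact_mod_cast h'
      omega
    have hK₀z : (2 : ℤ) ^ (s' + 1) + 2 ≤ (K₀ : ℤ) := by exact_mod_cast hK₀'
    have h2s : (2 : ℤ) ^ (s' + 1) = 2 * 2 ^ s' := by rw [pow_succ]; ring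
    have habs := abs_le.mp hmz
    have hmK₀ : m ∈ win K₀ := by rw [mem_win]; omega
    have hmK : m ∈ win K := by rw [mem_win]; omega
    have h2m : 2 * m + pm ∈ win K₀ := by
      rw [mem_win]; rcases hpm' with h | h <;> rw [h] <;> omega
    simp only [hFresh, if_pos hmK₀, if_pos hmK]
    rw [modeProfile_child_inputState_V_eq hβ0 hβ1 hd hK₀ hK hpn h2m]
  · rfl

/-- The window grows by the two end points. -/
theorem win_succ (K : ℕ) : win (K + 1) = insert (-((K : ℤ) + 1)) (insert ((K : ℤ) + 1) (win K)) := by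
  ext n
  simp only [win, Finset.mem_Icc, Finset.mem_insert, Nat.cast_add, Nat.cast_one]
  omega

/-- Splitting a window sum at the two new end points. -/
theorem sum_win_succ (f : ℤ → ℝ) (K : ℕ) :
    ∑ n ∈ win (K + 1), f n = f (-((K : ℤ) + 1)) + (f ((K : ℤ) + 1) + ∑ n ∈ win K, f n) := by
  rw [win_succ, Finset.sum_insert, Finset.sum_insert]
  · simp only [win, Finset.mem_Icc]; omega
  · simp only [win, Finset.mem_insert, Finset.mem_Icc]; omega

/-- **The column tail:** `Σ_{K₀ < |n| ≤ K} 1/(|n|−1)² ≤ 2/(K₀−1)` (`K₀ ≥ 2`; telescoping). -/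
theorem sum_win_tail_inv_sq_le {K₀ : ℕ} (hK₀ : 2 ≤ K₀) {K : ℕ} (hK : K₀ ≤ K) :
    ∑ n ∈ win K, (if n ∈ win K₀ then (0 : ℝ) else 1 / ((|(n : ℝ)| - 1) ^ 2)) ≤ 2 / ((K₀ : ℝ) - 1) - 2 / ((K : ℝ) - 1) := by
  induction K, hK using Nat.le_induction with
  | base => rw [Finset.sum_eq_zero fun n hn => if_pos hn]; simp
  | succ K hKK ih =>
    have hK1 : (1 : ℝ) ≤ (K : ℝ) - 1 := by
      have : (2 : ℝ) ≤ K := by exact_mod_cast hK₀.trans hKK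
      linarith
    rw [sum_win_succ]
    have hn1 : (-((K : ℤ) + 1)) ∉ win K₀ := by rw [mem_win]; omega
    have hn2 : ((K : ℤ) + 1) ∉ win K₀ := by rw [mem_win]; omega
    rw [if_neg hn1, if_neg hn2]
    have e1 : |((-((K : ℤ) + 1) : ℤ) : ℝ)| - 1 = K := by push_cast; rw [abs_of_neg (by linarith)]; ring
    have e2 : |((((K : ℤ) + 1) : ℤ) : ℝ)| - 1 = K := by push_cast; rw [abs_of_pos (by linarith)]; ring
    rw [e1, e2]
    push_cast
    have hK0 : (0 : ℝ) < K := by linarith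
    have key : 1 / (K : ℝ) ^ 2 + 1 / (K : ℝ) ^ 2 ≤ 2 / ((K : ℝ) - 1) - 2 / ((K : ℝ) + 1 - 1) := by
      rw [show (K : ℝ) + 1 - 1 = K by ring, show 2 / ((K : ℝ) - 1) - 2 / K = 2 / (((K : ℝ) - 1) * K) by field_simp; ring,
        show 1 / (K : ℝ) ^ 2 + 1 / (K : ℝ) ^ 2 = 2 / ((K : ℝ) ^ 2) by ring]
      exact div_le_div_of_nonneg_left (by norm_num) (by nlinarith) (by nlinarith)
    linarith

/-- `‖hPairState β q m n‖² ≤ 2(‖q m 0‖² + ‖q m 1‖²)`. -/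
theorem norm_sq_hPairState_le (β : ℝ) (q : ℤ → Fin 2 → ℂ) (m n : ℤ) :
    ‖hPairState β q m n‖ ^ 2 ≤ 2 * (‖q m 0‖ ^ 2 + ‖q m 1‖ ^ 2) := by
  have h1 : ‖hPairState β q m n‖ ≤ ‖q m 0‖ + ‖q m 1‖ := by
    simp only [hPairState]
    refine (norm_add_le _ _).trans (le_of_eq ?_)
    rw [norm_mul, norm_mul, show -((Real.pi * (β + n) / 2 : ℝ) : ℂ) * Complex.I = ((-(Real.pi * (β + n) / 2) : ℝ) : ℂ) * Complex.I by push_cast; ring,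
      Complex.norm_exp_ofReal_mul_I, Complex.norm_exp_ofReal_mul_I, mul_one, mul_one]
  have h0 : 0 ≤ ‖hPairState β q m n‖ := norm_nonneg _
  nlinarith [sq_nonneg (‖q m 0‖ - ‖q m 1‖)]

/-- `hPairState` vanishes on rows where the densities vanish. -/
theorem hPairState_eq_zero_of (β : ℝ) {q : ℤ → Fin 2 → ℂ} {m : ℤ} (hq : q m = 0) (n : ℤ) : hPairState β q m n = 0 := by
  simp [hPairState, hq]

/-- **Bessel per column.** For a lattice state `Z` supported on the rows of `win K₀ ⊆ win K′`, every column of `vTransport … K′ Z` has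
`Σ_{m′ ∈ win K′} ‖vTransport … K′ Z m′ n‖² ≤ Σ_{m ∈ win K₀} ‖Z m n‖²` (the transport phase is unimodular; Parseval for the column profile). -/
theorem sum_norm_sq_vTransport_col_le (α β θ : ℝ) {K₀ K' : ℕ} (hK : K₀ ≤ K') (Z : CState) (hZ : ∀ m, m ∉ win K₀ → ∀ n, Z m n = 0)
    {n : ℤ} (hn : n ∈ win K') (S : Finset ℤ) (hS : S ⊆ win K') :
    ∑ m' ∈ S, ‖vTransport α β θ K' Z m' n‖ ^ 2 ≤ ∑ m ∈ win K₀, ‖Z m n‖ ^ 2 := by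
  have hsub : win K₀ ⊆ win K' := by
    intro x hx; rw [mem_win] at hx ⊢; omega
  set g : ℝ → ℂ := fun x => (∑ m ∈ win K₀, Z m n * Complex.exp ((2 * Real.pi * (α + m) * x : ℝ) * Complex.I)) *
    Complex.exp (-((2 * Real.pi * (β + n) * θ * triWave x : ℝ) : ℂ) * Complex.I) with hg
  have hgc : Continuous g := by
    rw [hg]
    exact (continuous_blochPoly α (win K₀) (fun m => Z m n)).mul (continuous_transportPhase (β + n) θ)
  have hPn : ∀ y : ℝ, (∑ m ∈ win K', Z m n * Complex.exp ((2 * Real.pi * (α + m) * y : ℝ) * Complex.I)) =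
      ∑ m ∈ win K₀, Z m n * Complex.exp ((2 * Real.pi * (α + m) * y : ℝ) * Complex.I) :=
    fun y => (Finset.sum_subset hsub fun m _ hm => by rw [hZ m hm n, zero_mul]).symm
  have hcol : ∀ m' ∈ S, vTransport α β θ K' Z m' n = ∫ y in (-(1 / 2 : ℝ))..(1 / 2), g y * Complex.exp (-(2 * Real.pi * (α + m') * y : ℝ) * Complex.I) := by
    intro m' hm'
    rw [vTransport_apply_of_mem α β θ K' Z (hS hm') hn, hg]
    exact intervalIntegral.integral_congr fun y _ => by simp only [hPn y]
  rw [Finset.sum_congr rfl fun m' hm' => by rw [hcol m' hm']]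
  have hP := hasSum_sq_coeff hgc α
  have hB := sum_le_hasSum S (fun m' _ => by positivity) hP
  refine hB.trans (le_of_eq ?_)
  have e : ∀ y : ℝ, ‖g y‖ ^ 2 = ‖∑ m ∈ win K₀, Z m n * Complex.exp ((2 * Real.pi * (α + m) * y : ℝ) * Complex.I)‖ ^ 2 := by
    intro y
    rw [hg]
    simp only
    rw [norm_mul, show -((2 * Real.pi * (β + n) * θ * triWave y : ℝ) : ℂ) * Complex.I =
      ((-(2 * Real.pi * (β + n) * θ * triWave y) : ℝ) : ℂ) * Complex.I by push_cast; ring, Complex.norm_exp_ofReal_mul_I, mul_one]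
  simp_rw [e]
  exact integral_norm_sq_blochPoly α (win K₀) (fun m => Z m n)

/-- **(F2) + (T): the annulus tail.** For an H-pair density `Q` supported on the rows of `win K₀` (class `(α′, β′) ∈ [0,1)²`, any strain, `2 ≤ K₀ ≤ K`):
`cEnergy α′ β′ 1 K (vTransport … K (hPairState β′ Q)) ≤ cEnergy α′ β′ 1 K₀ (vTransport … K₀ (hPairState β′ Q)) + Q_tot/(2π²(K₀−1))`,
`Q_tot = Σ_m (‖Q m 0‖² + ‖Q m 1‖²)`. -/
theorem cEnergy_vTransport_hPair_trunc_le {α' β' : ℝ} (hα0 : 0 ≤ α') (hα1 : α' < 1) (hβ0 : 0 ≤ β') (hβ1 : β' < 1) (θ : ℝ) {K₀ K : ℕ}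
    (hK₀ : 2 ≤ K₀) (hK : K₀ ≤ K) (Q : ℤ → Fin 2 → ℂ) (hQ : ∀ m, m ∉ win K₀ → Q m = 0) :
    cEnergy α' β' 1 K (vTransport α' β' θ K (hPairState β' Q)) ≤
      cEnergy α' β' 1 K₀ (vTransport α' β' θ K₀ (hPairState β' Q)) +
        (∑ m ∈ win K₀, (‖Q m 0‖ ^ 2 + ‖Q m 1‖ ^ 2)) / (2 * Real.pi ^ 2 * ((K₀ : ℝ) - 1)) := by
  set Z : CState := hPairState β' Q with hZdef
  have hZ : ∀ m, m ∉ win K₀ → ∀ n, Z m n = 0 := fun m hm n => hPairState_eq_zero_of β' (hQ m hm) n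
  set Qt : ℝ := ∑ m ∈ win K₀, (‖Q m 0‖ ^ 2 + ‖Q m 1‖ ^ 2) with hQt
  have hQt0 : 0 ≤ Qt := Finset.sum_nonneg fun _ _ => by positivity
  have hsub : win K₀ ⊆ win K := by
    intro x hx; rw [mem_win] at hx ⊢; omega
  have hK₀r : (2 : ℝ) ≤ K₀ := by exact_mod_cast hK₀
  have hK₀1 : 0 < (K₀ : ℝ) - 1 := by linarith
  -- column Parseval: `Σ_{m'} ‖vT Z m' n‖² ≤ 2 Qt` for every window containing `win K₀`
  have hcolZ : ∀ n : ℤ, ∑ m ∈ win K₀, ‖Z m n‖ ^ 2 ≤ 2 * Qt := by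
    intro n
    rw [hQt, Finset.mul_sum]
    exact Finset.sum_le_sum fun m _ => norm_sq_hPairState_le β' Q m n
  -- the common coefficients: on `win K₀²` the two truncations agree
  have hagree : ∀ m' ∈ win K₀, ∀ n ∈ win K₀, vTransport α' β' θ K Z m' n = vTransport α' β' θ K₀ Z m' n := by
    intro m' hm' n hn
    rw [vTransport_apply_of_mem α' β' θ K Z (hsub hm') (hsub hn), vTransport_apply_of_mem α' β' θ K₀ Z hm' hn]
    congr 1
    funext y
    rw [Finset.sum_subset hsub fun m _ hm => by rw [hZ m hm n, zero_mul]]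
  -- the level-1 weight
  have hw : ∀ (m' n : ℤ), 0 < 4 * Real.pi ^ 2 * (4 : ℝ) ^ (1 : ℕ) * ((α' + m') ^ 2 + (β' + n) ^ 2) ∨
      (α' + m') ^ 2 + (β' + n) ^ 2 = 0 := by
    intro m' n
    rcases (add_nonneg (sq_nonneg (α' + (m' : ℝ))) (sq_nonneg (β' + (n : ℝ)))).eq_or_lt with h | h
    · exact Or.inr h.symm
    · exact Or.inl (by positivity)
  -- pointwise weights
  have hwcol : ∀ (m' n : ℤ), n ∉ win K₀ →
      ‖vTransport α' β' θ K Z m' n‖ ^ 2 / (4 * Real.pi ^ 2 * (4 : ℝ) ^ (1 : ℕ) * ((α' + m') ^ 2 + (β' + n) ^ 2)) ≤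
        ‖vTransport α' β' θ K Z m' n‖ ^ 2 * (1 / (16 * Real.pi ^ 2 * (|(n : ℝ)| - 1) ^ 2)) := by
    intro m' n hn
    rw [mem_win, not_and_or, not_le, not_le] at hn
    have hn1 : (K₀ : ℝ) ≤ |(n : ℝ)| - 1 := by
      rcases hn with h | h
      · have : (n : ℝ) ≤ -(K₀ : ℝ) - 1 := by exact_mod_cast (show n ≤ -(K₀ : ℤ) - 1 by omega)
        rw [abs_of_neg (by linarith)]; linarith
      · have : (K₀ : ℝ) + 1 ≤ n := by exact_mod_cast (show (K₀ : ℤ) + 1 ≤ n by omega)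
        rw [abs_of_pos (by linarith)]; linarith
    have hpos : 0 < |(n : ℝ)| - 1 := by linarith
    have hb : (|(n : ℝ)| - 1) ^ 2 ≤ (β' + n) ^ 2 := by
      have : |(n : ℝ)| - 1 ≤ |β' + n| := by
        have := abs_add_le (β' + n) (-β'); rw [abs_neg, abs_of_nonneg hβ0, show β' + (n : ℝ) + -β' = n by ring] at this; linarith
      calc (|(n : ℝ)| - 1) ^ 2 ≤ |β' + n| ^ 2 := pow_le_pow_left₀ hpos.le this 2
        _ = (β' + n) ^ 2 := sq_abs _
    rw [div_eq_mul_one_div]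
    refine mul_le_mul_of_nonneg_left (one_div_le_one_div_of_le (by positivity) ?_) (sq_nonneg _)
    rw [pow_one]; nlinarith [sq_nonneg (α' + (m' : ℝ))]
  have hwrow : ∀ (m' n : ℤ), m' ∉ win K₀ →
      ‖vTransport α' β' θ K Z m' n‖ ^ 2 / (4 * Real.pi ^ 2 * (4 : ℝ) ^ (1 : ℕ) * ((α' + m') ^ 2 + (β' + n) ^ 2)) ≤
        ‖vTransport α' β' θ K Z m' n‖ ^ 2 * (1 / (16 * Real.pi ^ 2 * (K₀ : ℝ) ^ 2)) := by
    intro m' n hm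
    rw [mem_win, not_and_or, not_le, not_le] at hm
    have hm1 : (K₀ : ℝ) ≤ |(m' : ℝ)| - 1 := by
      rcases hm with h | h
      · have : (m' : ℝ) ≤ -(K₀ : ℝ) - 1 := by exact_mod_cast (show m' ≤ -(K₀ : ℤ) - 1 by omega)
        rw [abs_of_neg (by linarith)]; linarith
      · have : (K₀ : ℝ) + 1 ≤ m' := by exact_mod_cast (show (K₀ : ℤ) + 1 ≤ m' by omega)
        rw [abs_of_pos (by linarith)]; linarith
    have hb : (K₀ : ℝ) ^ 2 ≤ (α' + m') ^ 2 := by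
      have h1 : |(m' : ℝ)| - 1 ≤ |α' + m'| := by
        have := abs_add_le (α' + m') (-α'); rw [abs_neg, abs_of_nonneg hα0, show α' + (m' : ℝ) + -α' = m' by ring] at this; linarith
      calc (K₀ : ℝ) ^ 2 ≤ (|(m' : ℝ)| - 1) ^ 2 := pow_le_pow_left₀ (by linarith) hm1 2
        _ ≤ |α' + m'| ^ 2 := pow_le_pow_left₀ (by linarith) h1 2
        _ = (α' + m') ^ 2 := sq_abs _
    rw [div_eq_mul_one_div]
    refine mul_le_mul_of_nonneg_left (one_div_le_one_div_of_le (by positivity) ?_) (sq_nonneg _)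
    rw [pow_one]; nlinarith [sq_nonneg (β' + (n : ℝ))]
  -- abbreviate the summand and split the window sum
  set F : ℤ → ℤ → ℝ := fun m' n =>
    ‖vTransport α' β' θ K Z m' n‖ ^ 2 / (4 * Real.pi ^ 2 * (4 : ℝ) ^ (1 : ℕ) * ((α' + m') ^ 2 + (β' + n) ^ 2)) with hF
  have hF0 : ∀ m' n, 0 ≤ F m' n := fun m' n => by rw [hF]; positivity
  have hinter : win K ∩ win K₀ = win K₀ := Finset.inter_eq_right.mpr hsub
  have hsplit1 : ∀ m' : ℤ, ∑ n ∈ win K, F m' n = (∑ n ∈ win K₀, F m' n) + ∑ n ∈ win K, (if n ∈ win K₀ then 0 else F m' n) := by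
    intro m'
    have e1 : ∑ n ∈ win K, F m' n = ∑ n ∈ win K, ((if n ∈ win K₀ then F m' n else 0) + (if n ∈ win K₀ then 0 else F m' n)) :=
      Finset.sum_congr rfl fun n _ => by split_ifs <;> simp
    rw [e1, Finset.sum_add_distrib, Finset.sum_ite_mem, hinter]
  have hsplit2 : ∑ m' ∈ win K, ∑ n ∈ win K₀, F m' n =
      (∑ m' ∈ win K₀, ∑ n ∈ win K₀, F m' n) + ∑ m' ∈ win K, (if m' ∈ win K₀ then 0 else ∑ n ∈ win K₀, F m' n) := by
    have e1 : ∑ m' ∈ win K, ∑ n ∈ win K₀, F m' n =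
        ∑ m' ∈ win K, ((if m' ∈ win K₀ then ∑ n ∈ win K₀, F m' n else 0) + (if m' ∈ win K₀ then 0 else ∑ n ∈ win K₀, F m' n)) :=
      Finset.sum_congr rfl fun m' _ => by split_ifs <;> simp
    rw [e1, Finset.sum_add_distrib, Finset.sum_ite_mem, hinter]
  have hcore : ∑ m' ∈ win K₀, ∑ n ∈ win K₀, F m' n = cEnergy α' β' 1 K₀ (vTransport α' β' θ K₀ Z) := by
    unfold cEnergy
    refine Finset.sum_congr rfl fun m' hm' => Finset.sum_congr rfl fun n hn => ?_
    rw [hF]; simp only; rw [hagree m' hm' n hn]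
  -- the far columns
  have hcol : ∑ m' ∈ win K, ∑ n ∈ win K, (if n ∈ win K₀ then 0 else F m' n) ≤ Qt / (8 * Real.pi ^ 2) * (2 / ((K₀ : ℝ) - 1)) := by
    rw [Finset.sum_comm]
    have step : ∀ n ∈ win K, ∑ m' ∈ win K, (if n ∈ win K₀ then 0 else F m' n) ≤
        Qt / (8 * Real.pi ^ 2) * (if n ∈ win K₀ then (0 : ℝ) else 1 / ((|(n : ℝ)| - 1) ^ 2)) := by
      intro n hn
      split_ifs with hn0
      · simp
      · calc ∑ m' ∈ win K, F m' n ≤ ∑ m' ∈ win K, ‖vTransport α' β' θ K Z m' n‖ ^ 2 * (1 / (16 * Real.pi ^ 2 * (|(n : ℝ)| - 1) ^ 2)) :=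
              Finset.sum_le_sum fun m' _ => by rw [hF]; exact hwcol m' n hn0
          _ = (∑ m' ∈ win K, ‖vTransport α' β' θ K Z m' n‖ ^ 2) * (1 / (16 * Real.pi ^ 2 * (|(n : ℝ)| - 1) ^ 2)) := by
              rw [Finset.sum_mul]
          _ ≤ (2 * Qt) * (1 / (16 * Real.pi ^ 2 * (|(n : ℝ)| - 1) ^ 2)) :=
              mul_le_mul_of_nonneg_right ((sum_norm_sq_vTransport_col_le α' β' θ hK Z hZ hn (win K) le_rfl).trans (hcolZ n))
                (by positivity)
          _ = Qt / (8 * Real.pi ^ 2) * (1 / (|(n : ℝ)| - 1) ^ 2) := by field_simp; ring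
    refine (Finset.sum_le_sum step).trans ?_
    rw [← Finset.mul_sum]
    refine mul_le_mul_of_nonneg_left ((sum_win_tail_inv_sq_le hK₀ hK).trans ?_) (by positivity)
    have : 0 ≤ 2 / ((K : ℝ) - 1) := by
      have : (2 : ℝ) ≤ K := by exact_mod_cast hK₀.trans hK
      exact div_nonneg (by norm_num) (by linarith)
    linarith
  -- the far rows
  have hrow : ∑ m' ∈ win K, (if m' ∈ win K₀ then 0 else ∑ n ∈ win K₀, F m' n) ≤ (2 * (K₀ : ℝ) + 1) * (2 * Qt) * (1 / (16 * Real.pi ^ 2 * (K₀ : ℝ) ^ 2)) := by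
    have step : ∀ m' ∈ win K, (if m' ∈ win K₀ then 0 else ∑ n ∈ win K₀, F m' n) ≤
        ∑ n ∈ win K₀, ‖vTransport α' β' θ K Z m' n‖ ^ 2 * (1 / (16 * Real.pi ^ 2 * (K₀ : ℝ) ^ 2)) := by
      intro m' _
      split_ifs with hm0
      · exact Finset.sum_nonneg fun _ _ => by positivity
      · exact Finset.sum_le_sum fun n _ => by rw [hF]; exact hwrow m' n hm0
    refine (Finset.sum_le_sum step).trans ?_
    rw [Finset.sum_comm]
    simp_rw [← Finset.sum_mul]
    refine mul_le_mul_of_nonneg_right ?_ (by positivity)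
    calc ∑ n ∈ win K₀, ∑ m' ∈ win K, ‖vTransport α' β' θ K Z m' n‖ ^ 2 ≤ ∑ n ∈ win K₀, 2 * Qt :=
          Finset.sum_le_sum fun n hn => (sum_norm_sq_vTransport_col_le α' β' θ hK Z hZ (hsub hn) (win K) le_rfl).trans (hcolZ n)
      _ = (2 * (K₀ : ℝ) + 1) * (2 * Qt) := by
          rw [Finset.sum_const, nsmul_eq_mul]
          congr 1
          simp only [win, Int.card_Icc]
          rw [show (K₀ : ℤ) + 1 - -(K₀ : ℤ) = ((2 * K₀ + 1 : ℕ) : ℤ) by push_cast; ring, Int.toNat_natCast]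
          push_cast; ring
  -- assemble
  change ∑ m' ∈ win K, ∑ n ∈ win K, F m' n ≤ cEnergy α' β' 1 K₀ (vTransport α' β' θ K₀ Z) + Qt / (2 * Real.pi ^ 2 * ((K₀ : ℝ) - 1))
  rw [Finset.sum_congr rfl fun m' _ => hsplit1 m', Finset.sum_add_distrib, hsplit2, hcore, add_assoc]
  refine add_le_add le_rfl ((add_le_add hrow hcol).trans ?_)
  -- `(2K₀+1)·2/(16π²K₀²) + 2/(8π²(K₀−1)) ≤ 1/(2π²(K₀−1))`
  have hK₀0 : 0 < (K₀ : ℝ) := by linarith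
  rw [show (2 * (K₀ : ℝ) + 1) * (2 * Qt) * (1 / (16 * Real.pi ^ 2 * (K₀ : ℝ) ^ 2)) + Qt / (8 * Real.pi ^ 2) * (2 / ((K₀ : ℝ) - 1)) =
      Qt * ((2 * (K₀ : ℝ) + 1) / (8 * Real.pi ^ 2 * (K₀ : ℝ) ^ 2) + 1 / (4 * Real.pi ^ 2 * ((K₀ : ℝ) - 1))) by field_simp; ring,
    show Qt / (2 * Real.pi ^ 2 * ((K₀ : ℝ) - 1)) = Qt * (1 / (2 * Real.pi ^ 2 * ((K₀ : ℝ) - 1))) by ring]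
  refine mul_le_mul_of_nonneg_left ?_ hQt0
  rw [div_add_div _ _ (by positivity) (by positivity), div_le_div_iff₀ (by positivity) (by positivity)]
  have hπ : 0 < Real.pi ^ 2 := by positivity
  nlinarith [mul_pos hπ hK₀0, mul_pos hπ hK₀1, mul_pos (mul_pos hπ hK₀0) hK₀1, mul_pos (mul_pos hπ hK₀0) hK₀0]

/-- The fresh H densities restricted to the target shell vanish outside the window (trivially: `hFresh` is windowed). -/
theorem restrictShell_hFresh_eq_zero_of_not_mem (s' : ℕ) (α' β' θ : ℝ) (K : ℕ) (ζ : CState) {m : ℤ} (hm : m ∉ win K) :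
    restrictShell s' α' (hFresh α' β' θ K ζ) m = 0 := by
  funext i
  simp [restrictShell, hFresh, hm]

/-- Bookkeeping over the four children: `Σ (f + g/c) = Σ f + (Σ g)/c`. -/
theorem sum_parities_add_div (f g : ℤ → ℤ → ℝ) (c : ℝ) :
    ∑ pm ∈ parities, ∑ pn ∈ parities, (f pm pn + g pm pn / c) =
      (∑ pm ∈ parities, ∑ pn ∈ parities, f pm pn) + (∑ pm ∈ parities, ∑ pn ∈ parities, g pm pn) / c := by
  rw [Finset.sum_div, ← Finset.sum_add_distrib]
  refine Finset.sum_congr rfl fun pm _ => ?_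
  rw [Finset.sum_div, ← Finset.sum_add_distrib]

/-- **(R-K) FOR THE V→H BLOCK, BY NAME** (A28-1 (c)). Parent class `(α, β) ∈ [0,1)²`, any strain `θ`, source shell `s`, target shell `s′`,
truncations `K₀ ≤ K` with `2^s + 1 ≤ K₀` and `2^{s′+1} + 2 ≤ K₀`. IF at the single truncation `K₀` every V source `d` of shell `s` satisfies
`Σ_children outEnergy_H^{(K₀)} + Q(d)/(2π²(K₀−1)) ≤ M²·E_{K₀}(d)`, where `Q(d)` is the sum of the squared fresh H densities of the four children on the
shell-`s′` rows (the engine's Rayleigh quotient with one explicit extra diagonal term), THEN `Transfer α β θ K V s H s′ M` — for EVERY `K ≥ K₀`.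
Creation-free: (F1) `restrictShell_hFresh_child_eq`, (F2)+(T) `cEnergy_vTransport_hPair_trunc_le`, (F3) `cEnergy_inputState_V_mono`. -/
theorem transfer_V_H_of_trunc {α β : ℝ} (hα0 : 0 ≤ α) (hα1 : α < 1) (hβ0 : 0 ≤ β) (hβ1 : β < 1) (θ : ℝ) {s s' K₀ K : ℕ}
    (hK₀s : 2 ^ s + 1 ≤ K₀) (hK₀s' : 2 ^ (s' + 1) + 2 ≤ K₀) (hK : K₀ ≤ K) {M : ℝ}
    (h : ∀ d : ℤ → Fin 2 → ℂ, SupportedInW s β K₀ d →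
      (∑ pm ∈ parities, ∑ pn ∈ parities,
          outEnergy ((α + pm) / 2) ((β + pn) / 2) θ K₀ s'
            (phasePieces ((α + pm) / 2) ((β + pn) / 2) θ K₀ (child pm pn (inputState α β θ K₀ PType.V d))) PType.H) +
        (∑ pm ∈ parities, ∑ pn ∈ parities, ∑ m ∈ win K₀,
          (‖restrictShell s' ((α + pm) / 2) (hFresh ((α + pm) / 2) ((β + pn) / 2) θ K₀ (child pm pn (inputState α β θ K₀ PType.V d))) m 0‖ ^ 2 +
            ‖restrictShell s' ((α + pm) / 2) (hFresh ((α + pm) / 2) ((β + pn) / 2) θ K₀ (child pm pn (inputState α β θ K₀ PType.V d))) m 1‖ ^ 2)) /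
          (2 * Real.pi ^ 2 * ((K₀ : ℝ) - 1)) ≤
        M ^ 2 * cEnergy α β 0 K₀ (inputState α β θ K₀ PType.V d)) :
    Transfer α β θ K PType.V s PType.H s' M := by
  intro d hd
  have hdS : SupportedIn s β d := hd.1
  have hK₀2 : 2 ≤ K₀ := le_trans (by have := Nat.one_le_two_pow (n := s); omega) hK₀s
  -- `d` qualifies at truncation `K₀`
  have hdW₀ : SupportedInW s β K₀ d := by
    refine ⟨hdS, fun k hk => supportedIn_apply_eq_zero hβ0 hβ1 hdS ?_⟩
    rw [mem_win, not_and_or, not_le, not_le] at hk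
    have hK₀r : (2 : ℝ) ^ s + 1 ≤ (K₀ : ℝ) := by exact_mod_cast hK₀s
    have : (K₀ : ℝ) + 1 ≤ |(k : ℝ)| := by
      rcases hk with hk | hk
      · have h' : (k : ℝ) ≤ -(K₀ : ℝ) - 1 := by exact_mod_cast (show k ≤ -(K₀ : ℤ) - 1 by omega)
        rw [abs_of_neg (by linarith)]; linarith
      · have h' : (K₀ : ℝ) + 1 ≤ k := by exact_mod_cast (show (K₀ : ℤ) + 1 ≤ k by omega)
        rw [abs_of_pos (by linarith)]; linarith
    linarith
  have hmain := h d hdW₀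
  -- per child: the output at `K` is at most the output at `K₀` plus the child's tail
  have hchild : ∀ pm ∈ parities, ∀ pn ∈ parities,
      outEnergy ((α + pm) / 2) ((β + pn) / 2) θ K s'
          (phasePieces ((α + pm) / 2) ((β + pn) / 2) θ K (child pm pn (inputState α β θ K PType.V d))) PType.H ≤
        outEnergy ((α + pm) / 2) ((β + pn) / 2) θ K₀ s'
            (phasePieces ((α + pm) / 2) ((β + pn) / 2) θ K₀ (child pm pn (inputState α β θ K₀ PType.V d))) PType.H +
          (∑ m ∈ win K₀,
            (‖restrictShell s' ((α + pm) / 2) (hFresh ((α + pm) / 2) ((β + pn) / 2) θ K₀ (child pm pn (inputState α β θ K₀ PType.V d))) m 0‖ ^ 2 +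
              ‖restrictShell s' ((α + pm) / 2) (hFresh ((α + pm) / 2) ((β + pn) / 2) θ K₀ (child pm pn (inputState α β θ K₀ PType.V d))) m 1‖ ^ 2)) /
            (2 * Real.pi ^ 2 * ((K₀ : ℝ) - 1)) := by
    intro pm hpm pn hpn
    have hpm' : (pm : ℝ) = 0 ∨ (pm : ℝ) = 1 := by
      have : pm = 0 ∨ pm = 1 := by simpa [parities] using hpm
      rcases this with h | h <;> simp [h]
    have hpn' : (pn : ℝ) = 0 ∨ (pn : ℝ) = 1 := by
      have : pn = 0 ∨ pn = 1 := by simpa [parities] using hpn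
      rcases this with h | h <;> simp [h]
    have ha0 : 0 ≤ (α + pm) / 2 := by rcases hpm' with h | h <;> rw [h] <;> linarith
    have ha1 : (α + pm) / 2 < 1 := by rcases hpm' with h | h <;> rw [h] <;> linarith
    have hb0 : 0 ≤ (β + pn) / 2 := by rcases hpn' with h | h <;> rw [h] <;> linarith
    have hb1 : (β + pn) / 2 < 1 := by rcases hpn' with h | h <;> rw [h] <;> linarith
    simp only [outEnergy, outEnergyAt, phasePieces]
    rw [restrictShell_hFresh_child_eq hα0 hα1 hβ0 hβ1 θ hdS hK₀s hK₀s' hK hpm hpn]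
    exact cEnergy_vTransport_hPair_trunc_le ha0 ha1 hb0 hb1 θ hK₀2 hK _
      fun m hm => restrictShell_hFresh_eq_zero_of_not_mem s' _ _ θ K₀ _ hm
  calc (∑ pm ∈ parities, ∑ pn ∈ parities,
          outEnergy ((α + pm) / 2) ((β + pn) / 2) θ K s'
            (phasePieces ((α + pm) / 2) ((β + pn) / 2) θ K (child pm pn (inputState α β θ K PType.V d))) PType.H)
      ≤ ∑ pm ∈ parities, ∑ pn ∈ parities,
          (outEnergy ((α + pm) / 2) ((β + pn) / 2) θ K₀ s'
              (phasePieces ((α + pm) / 2) ((β + pn) / 2) θ K₀ (child pm pn (inputState α β θ K₀ PType.V d))) PType.H +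
            (∑ m ∈ win K₀,
              (‖restrictShell s' ((α + pm) / 2) (hFresh ((α + pm) / 2) ((β + pn) / 2) θ K₀ (child pm pn (inputState α β θ K₀ PType.V d))) m 0‖ ^ 2 +
                ‖restrictShell s' ((α + pm) / 2) (hFresh ((α + pm) / 2) ((β + pn) / 2) θ K₀ (child pm pn (inputState α β θ K₀ PType.V d))) m 1‖ ^ 2)) /
              (2 * Real.pi ^ 2 * ((K₀ : ℝ) - 1))) :=
        Finset.sum_le_sum fun pm hpm => Finset.sum_le_sum fun pn hpn => hchild pm hpm pn hpn
    _ = (∑ pm ∈ parities, ∑ pn ∈ parities,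
          outEnergy ((α + pm) / 2) ((β + pn) / 2) θ K₀ s'
            (phasePieces ((α + pm) / 2) ((β + pn) / 2) θ K₀ (child pm pn (inputState α β θ K₀ PType.V d))) PType.H) +
        (∑ pm ∈ parities, ∑ pn ∈ parities, ∑ m ∈ win K₀,
          (‖restrictShell s' ((α + pm) / 2) (hFresh ((α + pm) / 2) ((β + pn) / 2) θ K₀ (child pm pn (inputState α β θ K₀ PType.V d))) m 0‖ ^ 2 +
            ‖restrictShell s' ((α + pm) / 2) (hFresh ((α + pm) / 2) ((β + pn) / 2) θ K₀ (child pm pn (inputState α β θ K₀ PType.V d))) m 1‖ ^ 2)) /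
          (2 * Real.pi ^ 2 * ((K₀ : ℝ) - 1)) :=
        sum_parities_add_div
          (fun pm pn => outEnergy ((α + pm) / 2) ((β + pn) / 2) θ K₀ s'
            (phasePieces ((α + pm) / 2) ((β + pn) / 2) θ K₀ (child pm pn (inputState α β θ K₀ PType.V d))) PType.H)
          (fun pm pn => ∑ m ∈ win K₀,
            (‖restrictShell s' ((α + pm) / 2) (hFresh ((α + pm) / 2) ((β + pn) / 2) θ K₀ (child pm pn (inputState α β θ K₀ PType.V d))) m 0‖ ^ 2 +
              ‖restrictShell s' ((α + pm) / 2) (hFresh ((α + pm) / 2) ((β + pn) / 2) θ K₀ (child pm pn (inputState α β θ K₀ PType.V d))) m 1‖ ^ 2))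
          (2 * Real.pi ^ 2 * ((K₀ : ℝ) - 1))
    _ ≤ M ^ 2 * cEnergy α β 0 K₀ (inputState α β θ K₀ PType.V d) := hmain
    _ ≤ M ^ 2 * cEnergy α β 0 K (inputState α β θ K PType.V d) :=
        mul_le_mul_of_nonneg_left (cEnergy_inputState_V_mono α β θ hK d) (sq_nonneg M)


end

end Summit.AnomalousDissipation.AnomalousDissipation.Cruxes.K1LocalisedCascade.K2TruncationRK
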